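import Mathlib.NumberTheory.Padics.Complex
import Mathlib.Topology.Algebra.Ring.Basic
import Literature.NumberTheory.EllipticCurves.RankinSelbergLFunctionK
import Literature.NumberTheory.EllipticCurves.HeegnerPoints
import Literature.NumberTheory.EllipticCurves.GaloisAction
import Literature.NumberTheory.GaloisRepresentations.AlgebraicHeckeCharacterGrossencharakterProofs
import Literature.NumberTheory.GaloisRepresentations.GaloisRep
import HarnessLib

/-!
# The anticyclotomic `p`-adic `L`-function of Bertolini–Darmon–Prasanna in the normalisation of
# Castella 2018, Thm. 3.1: its receptacle `Λ_{R₀} = R₀⟦Γ⟧`, the twisted values `L(f/K, φ, 1)`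
# at algebraic Hecke characters, and the CHARACTERISING PREDICATE `IsBDPLFunction`

Trunk T-NT-EC (`Literature/NumberTheory/EllipticCurves`). Definition requests
`defn-IsBDPLFunction` (D1d) and — for the special value it needs — `defn-rankinSelbergValueHecke`
(D1b) of cell `b2b-bsdres`, team x11b3 (X11b at `p = 3`), line W0 (`cells/x11b3/LINE-W.md`,
`ROUTE-2.md` §1): the interface `(Λur, IsBDP, ordAtOne)` of the planner sketch
`b2b-bsdres-x11b3-r2/Sketch.lean` §1 is to be instantiated by `Λur := UnrSeries p`,
`IsBDP := IsBDPLFunction ι 𝔭 κ γ f ΩK Ωp`, `ordAtOne L := ord_p (constantCoeff L)` (value at the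
trivial character, `UnrSeries.hasValueAt_zero`), splitting the tree's composite
`Summit.BirchSwinnertonDyer.Rank1Residual.X11b.IMCLowerWaldspurgerOnTreeAt` into (IMC≥)@p and
(BDP)@p. HONEST FRAMING: definitions with bodies and ONE named fact (Castella's existence theorem,
`castella2018_exists_isBDPLFunction`, hypotheses complete, nothing asserted about X11b at `p = 3`,
where the statement is not in print).

## The printed statement (Castella, Camb. J. Math. 6 (2018) = arXiv:1704.06608, §3, p. 9)

"Let `f = ∑ a_n q^n ∈ S_2(Γ₀(N))` be the newform associated with `E`. Denote by `R₀` the completion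
of the ring of integers of the maximal unramified extension of `ℚ_p`, and set `Λ_{R₀} := Λ ⊗̂_{ℤ_p}
R₀`, where as before `Λ = ℤ_p⟦Γ⟧` is the anticyclotomic Iwasawa algebra" (`Γ = Gal(K_∞/K)`, the
anticyclotomic `ℤ_p`-extension, §2.1; "we identify the one-variable power series ring `ℤ_p⟦T⟧` with
`Λ` by sending `1 + T ↦ γ`" for a fixed topological generator `γ`, §2.2). **Theorem 3.1.** "There
exists a `p`-adic `L`-function `L_p(f) ∈ Λ_{R₀}` such that if `φ̂ : Γ → ℂ_p^×` is the `p`-adic avatar of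
an unramified anticyclotomic Hecke character `φ` with infinity type `(-n, n)` with `n > 0`, then
`L_p(f, φ̂) = Γ(n)Γ(n+1) · (1 - a_p p⁻¹ φ(𝔭) + ε_p φ²(𝔭))² · Ω_p^{4n} · L(f/K, φ, 1) / (π^{2n+1} ·
Ω_K^{4n})`, where `ε_p = p⁻¹` if `p ∤ N` and `ε_p = 0` otherwise, and `Ω_p ∈ R₀^×` and `Ω_K ∈ ℂ^×`
are CM periods." Setting (§2.1, §3): `E/ℚ` semistable of conductor `N`, `p ≥ 5` with `ρ̄_{E,p}`
irreducible, `K` imaginary quadratic with `p = 𝔭𝔭̄` split, and (Heeg): every prime factor of `N` is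
split or ramified in `K`. Proof: `L_p(f) := Tw_{ψ⁻¹}(ℒ_{𝔭,ψ}(f))` with `ℒ_{𝔭,ψ}(f)` the `p`-adic
`L`-function of Castella–Hsieh, Math. Ann. 370 (2018) = arXiv:1505.08165, Def. 3.5 / Prop. 3.6
(`p ∤ N`), "readily extends to the case `p ∣ N` … (cf. [Castella, Math. Ann. 2017 =
arXiv:1507.04260])".

CONVENTIONS (Castella–Hsieh 2018, §3.3, arXiv p. 9, verbatim): "A Hecke character
`χ : K^×\𝔸_K^× → ℂ^×` is called a Hecke character of infinity type `(m, n)` if `χ_∞(z) = z^m z̄^n`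
and is called anticyclotomic if `χ` is trivial on `𝔸^×`. The avatar `χ̂ : K^×\K̂^× → ℂ_p^×` of a
Hecke character `χ` of infinity type `(m, n)` is defined by `χ̂(z) = i_p ∘ i_∞⁻¹(χ(z)) z_𝔭^m z_𝔭̄^n`";
"Each Galois character `ρ : G_K → ℂ_p^×` shall be implicitly regarded as a character
`ρ : K^×\K̂^× → ℂ_p^×` via the reciprocity law map `rec_K`" (geometric normalisation). The tree's
`HeckeCharacter.HasInfinityType χ p q` means `χ((x,1)) = ∏_w ι_w(x_w)^{-p_w} \overline{ι_w(x_w)}^{-q_w}`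
near `1` (`archFactor`; `ι_w = extensionEmbedding w`), so Castella's infinity type `(-n, n)` READ
THROUGH MATHLIB'S EMBEDDING `w.embedding` OF THE (UNIQUE) INFINITE PLACE `w` OF `K` is the tree's
`HasInfinityType (fun _ ↦ n) (fun _ ↦ -n)`; the identification of `w.embedding` with Castella's
`i_∞|_K` is what makes `𝔭` "the prime induced by `i_p = ι⁻¹ ∘ i_∞`" — in `IsBDPLFunction` the prime
`𝔭` is a parameter, and the compatibility `k ∈ 𝔭 ↔ ‖ι⁻¹(w.embedding k)‖ < 1` is a hypothesis of the
named fact.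

ORIENTATION — WHICH SELMER DUAL A FRAME PAIRS WITH (doc-only note; no statement in this file
changes; bsd-eis RULINGS L31/L33, 2026-08-27, on the (C4) orientation verdict of seat bsd-littype-05
= cell bsd-eis c3h MEMO-2). A character `φ` in the range of `IsBDPLFunction ι 𝔭` (`ι` inducing
`𝔭`; Castella's display: type `(-n, n)`, `n > 0`, multiplier `(1 - a_p p⁻¹ φ(𝔭) + ε_p φ(𝔭)²)²` AT
`𝔭`) has, by the convention just quoted, an avatar `r` that is an unramified twist of `ε_cyc^{-n}`
on `G_{K_𝔭}` and of `ε_cyc^{n}` on `G_{K_𝔭̄}` (Castella–Hsieh §3.3: infinity type `(m, n)` ⇒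
`ρ|_{G_{K_𝔭}}` is an unramified twist of `ε_cyc^m`): Hodge–Tate weight `-n < 0` at `𝔭`, `+n` at `𝔭̄`.
That is the shape Castella–Hsieh's Def. 3.5 / Prop. 3.6 give for the `𝔭̄`-ADIC function — their
`𝔭`-adic `ℒ_{𝔭,ψ}(f)` interpolates at type `(n, -n)` with multiplier
`e_𝔭(f, χ) = (1 - a_p p^{-r} χ_𝔭̄(p) + χ_𝔭̄(p²) p⁻¹)²` at `𝔭̄` (arXiv:1505.08165 pp. 10–11) —, so
the predicate describes the image of Castella's `L_p(f) := Tw_{ψ⁻¹}(ℒ_{𝔭,ψ}(f))` under the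
involution `γ ↦ γ⁻¹` of `Λ_{R₀}` (equivalently the function built from `𝔭̄`), not `ℒ_𝔭` itself /
CGLS 2022 Thm. 2.1.1's `ℒ_v` at `v = 𝔭`. CONSEQUENCE for main-conjecture statements over the tree's
PRECOMPOSITION Selmer duals `Castella2018.AcSelmer.XAc … 𝔮 ∅ γ` (strict at `𝔮`; `(T·x)(s) =
x(conj_γ s) - x(s)`): the fibre of `XAc … 𝔮` at `r` is dual to `Sel_{str 𝔮}(K, E[p^∞] ⊗ r⁻¹)` up to
finite defect, and `E[p^∞] ⊗ r⁻¹` is Bloch–Kato-RELAXED at `𝔭` (weights `{n, n+1}`) and STRICT at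
`𝔭̄` (weights `{-n, -n+1}`); hence the `Λ`-adic partner of a frame at `(ι, 𝔭)` is `XAc … 𝔭̄` — the
strict prime is the one OPPOSITE to the prime the frame's embedding datum induces. This is the
layout of `KellerYin2024.thmD_…_OPEN`, `CastellaGrossiLeeSkinner2022.proofThm422_…` and
`Castella2018.erratumThm11Reoriented_…_OPEN`; a binder pairing a frame at `(ι, 𝔭)` with
`XAc … 𝔭` states the `γ ↦ γ⁻¹`-conjugate of print's main conjecture
(`Castella2018.erratumThm11_…_OPEN`, kept for its importers and flagged). ORIENTATION-BLIND, hence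
unaffected: the existence fact `castella2018_exists_isBDPLFunction` below (∃ only) and — granted the
complex-conjugation transport `XAc … 𝔭̄ ≃ₛₗ[γ ↦ γ⁻¹] XAc … 𝔭` for `E/ℚ` (standard; cell bsd-eis
c3h (R4), not yet a tree lemma) — every statement about values at the trivial character (`T = 0`,
`UnrSeries.hasValueAt_zero`; the constant term, `μ` and `λ` of a series are invariant under the
involution) together with all its consumers.

## Contents (tree vocabulary reused; nothing re-declared)

* §1 (request D1b) `heckeValueExtZero φ v` (`φ(ϖ_v)` extended by zero), the Euler product
  `rankinSelbergEulerProductHecke f φ s = L(f/K, φ, s)` for `f ∈ S_2(Γ₀(N))` and an idelic Hecke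
  character `φ` of ANY infinity type (verbatim the pattern of `rankinSelbergEulerProduct`, which is
  the case of finite-order `φ` given as a Galois character), the value through the entire
  continuation `IsRankinSelbergValueHecke` / `rankinSelbergValueHecke` (`∃!`-choice, junk `0`).
* §2 `unrIntegers p = R₀ ⊂ ℂ_p` — the closure of `ℤ_p[ζ : ζ^m = 1, p ∤ m] = 𝓞(ℚ_p^ur)`, i.e. the ring
  of integers of the completion of `ℚ_p^ur` — `UnrSeries p = R₀⟦T⟧ = Λ_{R₀}` (`1 + T ↔ γ`), and
  `UnrSeries.HasValueAt L x v`: `∑_k [T^k]L · x^k = v` in `ℂ_p` (value at the character `γ ↦ 1 + x`);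
  `hasValueAt_zero`: the value at the trivial character is the constant term.
* §3 the `p`-adic avatar AS A GALOIS CHARACTER in the tree's dictionary shape
  (`HeckeCharacter.exists_lAdic_isDeRhamFramed`): `IsPAdicAvatarOf ι φ r` — `r : Γ_K → GL₁(ℚ̄_p)`
  unramified at every `v ∤ p` where `φ` is, with `charpoly r(Frob_v^arith) = X - ι⁻¹(φ(ϖ_v))⁻¹`,
  i.e. `r(Frob_v^geom) = ι⁻¹(φ(ϖ_v))` = Castella–Hsieh's `χ̂ ∘ rec_K` — `FactorsThroughZp κ r`
  (`r` is a character of `Γ = Γ_K / ker κ`), `avatarValueAt r γ ∈ ℂ_p` (`φ̂(γ)`).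
* §4 `bdpInterpolationValue p f 𝔭 φ n ΩK ∈ ℂ` (the printed right-hand side without `Ω_p^{4n}`),
  **`IsBDPLFunction ι 𝔭 κ γ f ΩK Ωp L`** (the interpolation property, transported by `ι⁻¹ : ℂ → ℚ̄_p
  ⊂ ℂ_p`), and the named fact `castella2018_exists_isBDPLFunction` (Castella 2018, Thm. 3.1; the CM
  periods `Ω_K ∈ ℂ^×`, `Ω_p ∈ R₀^×` of Castella–Hsieh §2.5 are not in the tree and are therefore
  existentially quantified together with `L_p(f)` — weaker than, and implied by, the printed
  statement; note that `ord_p` of the value at the trivial character does not see the unit `Ω_p`).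

Anticyclotomicity is automatic in the range of interpolation: an everywhere unramified Hecke
character of `K` with infinity type `(-n, n)` is trivial on `𝕀_ℚ = ℚ^× · ℝ_{>0} · ∏_ℓ ℤ_ℓ^×`, so the
predicate quantifies over unramified `φ` of that infinity type only.

## References

* [Castella2018] F. Castella, *On the `p`-part of the Birch–Swinnerton-Dyer formula for
  multiplicative primes*, Camb. J. Math. 6 (2018), Thm. 3.1 (arXiv:1704.06608 p. 9), §2.1–2.2 (p. 5).
* [CastellaHsieh2018] F. Castella, M.-L. Hsieh, *Heegner cycles and `p`-adic `L`-functions*,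
  Math. Ann. 370 (2018), §3.3 (conventions, arXiv:1505.08165 p. 9), Def. 3.5, Prop. 3.6 (p. 10–11).
* [BertoliniDarmonPrasanna2013] M. Bertolini, H. Darmon, K. Prasanna, *Generalized Heegner cycles and `p`-adic Rankin
  `L`-series*, Duke Math. J. 162 (2013), §5 (Thm. 5.13: the value at the trivial character).
* [Nekovar1995] J. Nekovář, Math. Ann. 302 (1995), (0.5) and §3.4 (the twisted `L`-function
  `L(f ⊗ K, 𝒲, s)`; pattern of `RankinSelbergLFunctionK.lean`).
* [SerreAbelianLadic1968] J.-P. Serre, *Abelian ℓ-adic representations* (1968), Ch. II §2.7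
  (the `λ`-adic avatar).
-/

noncomputable section

open scoped MatrixGroups ModularForm Topology
open CongruenceSubgroup NumberField IsDedekindDomain Field Polynomial
open Literature.NumberTheory.GaloisRepresentations
open Literature.NumberTheory.EllipticCurves.ModularForms

namespace Literature.NumberTheory.EllipticCurves

universe u

/-! ### §1. `L(f/K, φ, s)` for an idelic Hecke character `φ` (request D1b) -/

section RankinSelbergHecke

variable {K : Type u} [Field K] [NumberField K] {N : ℕ}

open scoped Classical in
/-- **`φ(ϖ_v)` extended by zero**: the value of the Hecke character `φ` at (a uniformizer of) the
finite prime `v` (`HeckeCharacter.valueAtUniformizer`, independent of the uniformizer when `φ` is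
unramified at `v`) if `φ` is unramified at `v`, and `0` otherwise — the convention "extended by
zero to ideals that are not prime to the conductor" of Nekovář 1995, §3.4, here for characters of
arbitrary infinity type (Castella–Hsieh 2018, §3.3: "`χ(𝔞)` for `𝔞` prime to `𝔠`").
[cite: Nekovar1995, §3.4] -/
def heckeValueExtZero (φ : HeckeCharacter K) (v : HeightOneSpectrum (𝓞 K)) : ℂ :=
  if φ.IsUnramifiedAt v then φ.valueAtUniformizer v else 0

/-- At an unramified prime `heckeValueExtZero` is `φ(ϖ_v)` (Nekovář's `𝒲(λ)` for `λ` prime to the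
conductor). [cite: Nekovar1995, §3.4] -/
theorem heckeValueExtZero_of_isUnramifiedAt {φ : HeckeCharacter K} {v : HeightOneSpectrum (𝓞 K)}
    (h : φ.IsUnramifiedAt v) : heckeValueExtZero φ v = φ.valueAtUniformizer v := by
  rw [heckeValueExtZero, if_pos h]

/-- At a ramified prime `heckeValueExtZero` is `0` ("extended by zero to ideals that are not prime to
`𝔣`"). [cite: Nekovar1995, §3.4] -/
theorem heckeValueExtZero_of_not_isUnramifiedAt {φ : HeckeCharacter K}
    {v : HeightOneSpectrum (𝓞 K)} (h : ¬ φ.IsUnramifiedAt v) : heckeValueExtZero φ v = 0 := by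
  rw [heckeValueExtZero, if_neg h]

/-- **The inverse local factor of `L(f/K, φ, s)` at the finite prime `v` of `K`** for
`f ∈ S_2(Γ₀(N))` and an idelic Hecke character `φ` of `K` (any infinity type): with `N(v) = ℓ^k`,
`w = φ(ϖ_v)` (extended by zero) and `X = N(v)^{-s}`,
`(1 - α_ℓ^k w X)(1 - β_ℓ^k w X) = 1 - (α_ℓ^k + β_ℓ^k) w X + (α_ℓ β_ℓ)^k w² X²`, where
`α_ℓ + β_ℓ = a_ℓ(f)` (`cuspCoeff f ℓ`), `α_ℓ β_ℓ = ℓ · 𝟙_{ℓ ∤ N}`, `α^k + β^k = frobTracePow`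
(Nekovář 1995, (0.5)/§3.4; Castella–Hsieh 2018, §3.3 "`L(s, π_K ⊗ χ)`"). Verbatim the finite-order
definition `rankinSelbergLocalFactorInv` with `heckeValueAt χ v ↦ heckeValueExtZero φ v`.
[cite: Nekovar1995, (0.5) p. 611 and §3.4] -/
def rankinSelbergLocalFactorInvHecke (f : CuspForm (Gamma0 N) 2) (φ : HeckeCharacter K)
    (v : HeightOneSpectrum (𝓞 K)) (s : ℂ) : ℂ :=
  let q : ℕ := Ideal.absNorm v.asIdeal
  let ℓ : ℕ := q.minFac
  let k : ℕ := q.factorization ℓ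
  let e : ℂ := if ℓ ∣ N then 0 else ℓ
  let w : ℂ := heckeValueExtZero φ v
  1 - frobTracePow (cuspCoeff f ℓ) e k * w * (q : ℂ) ^ (-s) + e ^ k * w ^ 2 * (q : ℂ) ^ (-2 * s)

/-- **`L(f/K, φ, s)` as an Euler product** over the finite primes of `K` (a `tprod`; for unitary
`φ` — e.g. anticyclotomic of infinity type `(-n, n)`, `|φ(ϖ_v)| = 1` — absolutely convergent for
`re s > 3/2` by the Ramanujan bound; junk elsewhere, the continuation being handled by
`IsRankinSelbergValueHecke`). This is Castella's `L(f/K, φ, s)` (2018, Thm. 3.1), Castella–Hsieh's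
`L(s, π_K ⊗ χ)` up to the shift `s ↦ s - 1/2` of the unitary normalisation (their `L(1/2, π_K ⊗ χ)`
is the central value, here `s = 1`), Nekovář's `L(f ⊗ K, 𝒲, s)` for finite-order `𝒲`.
[cite: Castella2018, Thm. 3.1] [cite: Nekovar1995, §3.4] -/
def rankinSelbergEulerProductHecke (f : CuspForm (Gamma0 N) 2) (φ : HeckeCharacter K) (s : ℂ) :
    ℂ :=
  ∏' v : HeightOneSpectrum (𝓞 K), (rankinSelbergLocalFactorInvHecke f φ v s)⁻¹

/-- **`L₀` is the value at `s₀` of (the analytic continuation of) `L(f/K, φ, s)`**: every entire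
function agreeing with the Euler product for `re s > 3/2` takes the value `L₀` at `s₀` (the
continuation exists, is entire for cuspidal `f` and non-exceptional `φ`, and is unique; were there
none, every `L₀` would qualify — pattern of `IsRankinSelbergValue`). [cite: Nekovar1995, §1.6–1.7] -/
def IsRankinSelbergValueHecke (f : CuspForm (Gamma0 N) 2) (φ : HeckeCharacter K) (s₀ L₀ : ℂ) :
    Prop :=
  ∀ L : ℂ → ℂ, Differentiable ℂ L →
    (∀ s : ℂ, 3 / 2 < s.re → L s = rankinSelbergEulerProductHecke f φ s) → L s₀ = L₀

open scoped Classical in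
/-- **The special value `L(f/K, φ, s₀)`** through the continuation: the unique `L₀` with
`IsRankinSelbergValueHecke f φ s₀ L₀`, junk `0` if not unique. Castella 2018, Thm. 3.1 uses
`L(f/K, φ, 1)` for unramified anticyclotomic `φ` of infinity type `(-n, n)`, `n > 0`.
[cite: Castella2018, Thm. 3.1] -/
def rankinSelbergValueHecke (f : CuspForm (Gamma0 N) 2) (φ : HeckeCharacter K) (s₀ : ℂ) : ℂ :=
  if h : ∃! L₀ : ℂ, IsRankinSelbergValueHecke f φ s₀ L₀ then h.choose else 0

/-- Defining property of `rankinSelbergValueHecke` when the value is uniquely determined (the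
value of the continued `L(f ⊗ K, 𝒲, s)`). [cite: Nekovar1995, (0.5) p. 611 and §1.6–1.7] -/
theorem isRankinSelbergValueHecke_rankinSelbergValueHecke {f : CuspForm (Gamma0 N) 2}
    {φ : HeckeCharacter K} {s₀ : ℂ} (h : ∃! L₀ : ℂ, IsRankinSelbergValueHecke f φ s₀ L₀) :
    IsRankinSelbergValueHecke f φ s₀ (rankinSelbergValueHecke f φ s₀) := by
  rw [rankinSelbergValueHecke, dif_pos h]
  exact h.choose_spec.1

/-- Two entire continuations of the Euler product coincide (identity theorem; the continuation of
Nekovář 1995, §1.6–1.7 is unique). [cite: Nekovar1995, §1.6–1.7] -/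
theorem eq_of_isEntireContinuation_rankinSelbergHecke {f : CuspForm (Gamma0 N) 2}
    {φ : HeckeCharacter K} {L L₁ : ℂ → ℂ} (hL : Differentiable ℂ L)
    (hL' : ∀ s : ℂ, 3 / 2 < s.re → L s = rankinSelbergEulerProductHecke f φ s)
    (hL₁ : Differentiable ℂ L₁)
    (hL₁' : ∀ s : ℂ, 3 / 2 < s.re → L₁ s = rankinSelbergEulerProductHecke f φ s) : L₁ = L := by
  refine AnalyticOnNhd.eq_of_eventuallyEq (𝕜 := ℂ) (z₀ := 2) (fun z _ ↦ hL₁.analyticAt z)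
    (fun z _ ↦ hL.analyticAt z) ?_
  have hopen : IsOpen {s : ℂ | 3 / 2 < s.re} := isOpen_lt continuous_const Complex.continuous_re
  filter_upwards [hopen.mem_nhds (show (3 : ℝ) / 2 < (2 : ℂ).re by norm_num)] with s hs
  rw [hL₁' s hs, hL' s hs]

/-- If an entire continuation `L` of the Euler product exists, `rankinSelbergValueHecke` is its
value (Nekovář 1995, (0.5): the special value through the continuation of §1.6–1.7).
[cite: Nekovar1995, (0.5) p. 611 and §1.6–1.7] -/
theorem rankinSelbergValueHecke_eq {f : CuspForm (Gamma0 N) 2} {φ : HeckeCharacter K}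
    {L : ℂ → ℂ} (hL : Differentiable ℂ L)
    (hL' : ∀ s : ℂ, 3 / 2 < s.re → L s = rankinSelbergEulerProductHecke f φ s) (s₀ : ℂ) :
    rankinSelbergValueHecke f φ s₀ = L s₀ := by
  have hex : ∃! L₀ : ℂ, IsRankinSelbergValueHecke f φ s₀ L₀ := by
    refine ⟨L s₀, fun L₁ hL₁ hL₁' ↦ ?_, fun L₀ h ↦ (h L hL hL').symm⟩
    rw [eq_of_isEntireContinuation_rankinSelbergHecke hL hL' hL₁ hL₁']
  exact (isRankinSelbergValueHecke_rankinSelbergValueHecke hex L hL hL').symm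

end RankinSelbergHecke

/-! ### §2. The receptacle `Λ_{R₀} = R₀⟦T⟧` and values at characters of `Γ` -/

section Receptacle

variable (p : ℕ) [Fact p.Prime]

/-- **`R₀ ⊂ ℂ_p`, "the completion of the ring of integers of the maximal unramified extension of
`ℚ_p`"** (Castella 2018, §3, p. 9; Castella–Hsieh's `𝒲 = W(𝔽̄_p)`): the topological closure in
`ℂ_p` of the subring generated by the roots of unity of order prime to `p`. Indeed
`𝓞(ℚ_p^ur) = ⋃_{p ∤ m} ℤ_p[ζ_m] = ℤ_p[ζ_m : p ∤ m]`, the subring generated by these `ζ_m` contains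
`ℤ`, whose closure is `ℤ_p`, and the closure of `𝓞(ℚ_p^ur)` in the complete field `ℂ_p` is the ring
of integers of the completion `\widehat{ℚ_p^ur}` (the valuation being discrete on `ℚ_p^ur`).
[cite: Castella2018, §3 (p. 9)] -/
def unrIntegers : Subring ℂ_[p] :=
  (Subring.closure {ζ : ℂ_[p] | ∃ m : ℕ, 0 < m ∧ ¬ p ∣ m ∧ ζ ^ m = 1}).topologicalClosure

/-- **`Λ_{R₀} = Λ ⊗̂_{ℤ_p} R₀ = R₀⟦Γ⟧ ≅ R₀⟦T⟧`**, the receptacle of `L_p(f)` (Castella 2018, §3 with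
§2.2: "we identify the one-variable power series ring `ℤ_p⟦T⟧` with the Iwasawa algebra
`Λ = ℤ_p⟦Γ⟧` by sending `1 + T ↦ γ`" for a fixed topological generator `γ` of the anticyclotomic
`Γ = Gal(K_∞/K)`; tree: `ZpExtension.IsTopGenerator`). [cite: Castella2018, §2.2 and §3] -/
abbrev UnrSeries : Type := PowerSeries (unrIntegers p)

variable {p}

/-- **The value of `L ∈ R₀⟦T⟧` at the point `T = x` of the open unit disc of `ℂ_p`**:
`∑_k [T^k]L · x^k = v` (a `HasSum` in `ℂ_p`). The value `L(φ̂)` of `L ∈ R₀⟦Γ⟧` at a continuous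
character `φ̂ : Γ → ℂ_p^×` is the value at `x = φ̂(γ) - 1` (`γ ↦ 1 + T`); the trivial character is
`x = 0` (`hasValueAt_zero`). Pattern of the tree's `HasValueAt` (two-variable file) and
`IsPAdicLFunctionOf`. [cite: Castella2018, §2.2] -/
def UnrSeries.HasValueAt (L : UnrSeries p) (x v : ℂ_[p]) : Prop :=
  HasSum (fun k : ℕ ↦ ((PowerSeries.coeff k L : unrIntegers p) : ℂ_[p]) * x ^ k) v

/-! #### API -/

/-- Roots of unity of order prime to `p` lie in `R₀` (they generate `𝓞(ℚ_p^ur)` over `ℤ_p`).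
[cite: Castella2018, §3 (p. 9)] -/
theorem mem_unrIntegers_of_pow_eq_one {ζ : ℂ_[p]} {m : ℕ} (hm : 0 < m) (hpm : ¬ p ∣ m)
    (hζ : ζ ^ m = 1) : ζ ∈ unrIntegers p :=
  Subring.le_topologicalClosure _ (Subring.subset_closure ⟨m, hm, hpm, hζ⟩)

/-- `R₀` contains the integers (it is a subring of `ℂ_p`). [cite: Castella2018, §3 (p. 9)] -/
theorem intCast_mem_unrIntegers (n : ℤ) : (n : ℂ_[p]) ∈ unrIntegers p :=
  intCast_mem (unrIntegers p) n

/-- `R₀` is closed in `ℂ_p` ("the completion of the ring of integers of the maximal unramified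
extension"). [cite: Castella2018, §3 (p. 9)] -/
theorem isClosed_unrIntegers : IsClosed (unrIntegers p : Set ℂ_[p]) :=
  Subring.isClosed_topologicalClosure _

/-- **The value at the trivial character is the constant term**: `L(𝟙) = L(T = 0) = [T⁰]L` (under
`1 + T ↦ γ`; Castella 2018 reads values at `𝟙` as `f(0)`, §2.2 and Thm. 2.3, Thm. 3.2).
[cite: Castella2018, §2.2 and Thm. 3.2] -/
theorem UnrSeries.hasValueAt_zero (L : UnrSeries p) :
    L.HasValueAt 0 ((PowerSeries.constantCoeff L : unrIntegers p) : ℂ_[p]) := by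
  have h := hasSum_single (f := fun k : ℕ ↦
    ((PowerSeries.coeff k L : unrIntegers p) : ℂ_[p]) * (0 : ℂ_[p]) ^ k) 0
    (fun k hk ↦ by rw [zero_pow hk, mul_zero])
  simpa [UnrSeries.HasValueAt] using h

/-- The value at a point is unique (a `HasSum` limit in the Hausdorff space `ℂ_p`).
[cite: Castella2018, §2.2] -/
theorem UnrSeries.HasValueAt.unique {L : UnrSeries p} {x v v' : ℂ_[p]} (h : L.HasValueAt x v)
    (h' : L.HasValueAt x v') : v = v' :=
  HasSum.unique h h'

/-- The value of `L` at the trivial character, read off `hasValueAt_zero`: any `v` with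
`L.HasValueAt 0 v` is the constant term `L(0)`. [cite: Castella2018, §2.2 and Thm. 3.2] -/
theorem UnrSeries.eq_constantCoeff_of_hasValueAt_zero {L : UnrSeries p} {v : ℂ_[p]}
    (h : L.HasValueAt 0 v) : v = ((PowerSeries.constantCoeff L : unrIntegers p) : ℂ_[p]) :=
  h.unique L.hasValueAt_zero

end Receptacle

/-! ### §3. The `p`-adic avatar of a Hecke character as a character of `Γ_K` -/

section Avatar

variable {K : Type u} [Field K] {p : ℕ} [Fact p.Prime]

/-- **`r` factors through the `ℤ_p`-extension cut out by `κ`**: `r` is trivial on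
`ker κ = Gal(K̄/K_∞)`, i.e. `r` is (the inflation of) a character `Γ = Gal(K_∞/K) → ℚ̄_p^×`; then
`r` is determined on `Γ ≅ ℤ_p` by its value at a topological generator `γ` (`κ(γ) = 1`). Castella
2018, Thm. 3.1: "`φ̂ : Γ → ℂ_p^×`". [cite: Castella2018, Thm. 3.1] -/
def FactorsThroughZp {A : Type*} [CommRing A] [TopologicalSpace A] (κ : ZpExtension K p)
    (r : FramedGaloisRep K A 1) : Prop :=
  ∀ σ : absoluteGaloisGroup K, κ σ = 1 → r σ = 1

/-- **`φ̂(γ) ∈ ℂ_p`**: the value at `γ ∈ Γ_K` of a rank-one framed `p`-adic Galois representation,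
read in `ℂ_p ⊇ ℚ̄_p` (the `1 × 1` determinant). [cite: Castella2018, Thm. 3.1] -/
def avatarValueAt (r : FramedGaloisRep K (PadicAlgCl p) 1) (γ : absoluteGaloisGroup K) : ℂ_[p] :=
  (((Matrix.GeneralLinearGroup.det (r γ) : (PadicAlgCl p)ˣ) : PadicAlgCl p) : ℂ_[p])

/-- `φ̂(1) = 1` (`φ̂` is a character of `Γ`). [cite: Castella2018, Thm. 3.1] -/
@[simp] theorem avatarValueAt_one (r : FramedGaloisRep K (PadicAlgCl p) 1) :
    avatarValueAt r 1 = 1 := by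
  simp [avatarValueAt]

/-- `φ̂` is multiplicative in `γ` (`φ̂ : Γ → ℂ_p^×` is a character). [cite: Castella2018, Thm. 3.1] -/
theorem avatarValueAt_mul (r : FramedGaloisRep K (PadicAlgCl p) 1) (γ γ' : absoluteGaloisGroup K) :
    avatarValueAt r (γ * γ') = avatarValueAt r γ * avatarValueAt r γ' := by
  simp [avatarValueAt, map_mul, UniformSpace.Completion.coe_mul]

/-- If `r` factors through `κ` then `φ̂(σ) = 1` on `ker κ` (it is a character of `Γ = Γ_K / ker κ`).
[cite: Castella2018, Thm. 3.1] -/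
theorem avatarValueAt_eq_one_of_factorsThroughZp {κ : ZpExtension K p}
    {r : FramedGaloisRep K (PadicAlgCl p) 1} (h : FactorsThroughZp κ r) {σ : absoluteGaloisGroup K}
    (hσ : κ σ = 1) : avatarValueAt r σ = 1 := by
  rw [avatarValueAt, h σ hσ]
  simp

variable [NumberField K]

/-- **`r` is the `p`-adic avatar of the Hecke character `φ`, as a Galois character**, in the
dictionary shape of the tree's `HeckeCharacter.exists_lAdic_isDeRhamFramed` (Serre 1968, Ch. II
§2.7; Weil 1956): `r : Γ_K → GL₁(ℚ̄_p)` is unramified at every finite `v ∤ p` at which `φ` is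
unramified, and there the characteristic polynomial of an ARITHMETIC Frobenius is
`X - ι⁻¹(φ(ϖ_v))⁻¹`, i.e. `r(Frob_v^geom) = ι⁻¹(φ(ϖ_v))` — the normalisation "uniformizer ↦
geometric Frobenius" of the reciprocity map by which Castella–Hsieh 2018, §3.3 regard the avatar
`φ̂` as a Galois character. By Chebotarev and continuity such an `r` is unique; it exists for
algebraic `φ` (Weil; tree fact `HeckeCharacter.IsAlgebraic.exists_lAdic`). `ι : ℚ̄_p ≃ ℂ` is the
embedding datum `i_∞ ∘ i_p⁻¹` of the tree (`exists_lAdic_isDeRhamFramed`). (Were the reciprocity map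
normalised the other way — uniformizer ↦ arithmetic Frobenius — the avatar would be `r⁻¹`; on
`Λ_{R₀}` this is the involution `1 + T ↦ (1 + T)⁻¹`, which changes neither the existence statement
`castella2018_exists_isBDPLFunction` nor the value at the trivial character.)
[cite: CastellaHsieh2018, §3.3 (p. 9)] [cite: SerreAbelianLadic1968, Ch. II §2.7] -/
def IsPAdicAvatarOf (ι : PadicAlgCl p ≃+* ℂ) (φ : HeckeCharacter K)
    (r : FramedGaloisRep K (PadicAlgCl p) 1) : Prop :=
  ∀ v : HeightOneSpectrum (𝓞 K), ((p : ℕ) : 𝓞 K) ∉ v.asIdeal → φ.IsUnramifiedAt v →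
    r.IsUnramifiedAt v ∧ r.HasFrobCharpolyAt v (X - C (ι.symm (φ.valueAtUniformizer v))⁻¹)

end Avatar

/-! ### §4. The interpolation property (Castella 2018, Thm. 3.1) -/

section Interpolation

variable {K : Type u} [Field K] [NumberField K] {N : ℕ}

/-- **The complex part of Castella's interpolation value** at an unramified anticyclotomic Hecke
character `φ` of infinity type `(-n, n)`, `n > 0` (Castella 2018, Thm. 3.1, p. 9):
`Γ(n) Γ(n+1) · (1 - a_p p⁻¹ φ(𝔭) + ε_p φ(𝔭)²)² · L(f/K, φ, 1) / (π^{2n+1} · Ω_K^{4n})`, with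
`ε_p = p⁻¹` if `p ∤ N` and `ε_p = 0` otherwise, `a_p = a_p(f)` (`cuspCoeff f p`), `φ(𝔭)` the value
at the distinguished prime `𝔭 ∣ p` (`heckeValueExtZero`, `= φ.valueAtUniformizer 𝔭` for unramified
`φ`), `L(f/K, φ, 1) = rankinSelbergValueHecke f φ 1`, and `Ω_K ∈ ℂ^×` the complex CM period
(a parameter). The full printed value is this times `Ω_p^{4n}` (`IsBDPLFunction`).
[cite: Castella2018, Thm. 3.1] -/
def bdpInterpolationValue (p : ℕ) (f : CuspForm (Gamma0 N) 2) (𝔭 : HeightOneSpectrum (𝓞 K))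
    (φ : HeckeCharacter K) (n : ℕ) (ΩK : ℂ) : ℂ :=
  let εp : ℂ := if p ∣ N then 0 else ((p : ℂ))⁻¹
  let φ𝔭 : ℂ := heckeValueExtZero φ 𝔭
  Complex.Gamma n * Complex.Gamma (n + 1) *
    (1 - cuspCoeff f p * ((p : ℂ))⁻¹ * φ𝔭 + εp * φ𝔭 ^ 2) ^ 2 *
    rankinSelbergValueHecke f φ 1 / ((Real.pi : ℂ) ^ (2 * n + 1) * ΩK ^ (4 * n))

/-- In the factor `(1 - a_p p⁻¹ φ(𝔭) + ε_p φ(𝔭)²)²` the term `ε_p` vanishes when `p ∣ N`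
(multiplicative reduction): the value reduces to Castella's "`1 - a_p p⁻¹ φ(𝔭)` for unramified
`φ`" (proof of Thm. 3.1). [cite: Castella2018, Thm. 3.1 (proof)] -/
theorem bdpInterpolationValue_of_dvd {p : ℕ} (hpN : p ∣ N) (f : CuspForm (Gamma0 N) 2)
    (𝔭 : HeightOneSpectrum (𝓞 K)) (φ : HeckeCharacter K) (n : ℕ) (ΩK : ℂ) :
    bdpInterpolationValue p f 𝔭 φ n ΩK =
      Complex.Gamma n * Complex.Gamma (n + 1) *
        (1 - cuspCoeff f p * ((p : ℂ))⁻¹ * heckeValueExtZero φ 𝔭) ^ 2 *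
        rankinSelbergValueHecke f φ 1 / ((Real.pi : ℂ) ^ (2 * n + 1) * ΩK ^ (4 * n)) := by
  simp [bdpInterpolationValue, hpN]

variable {p : ℕ} [Fact p.Prime]

/-- **The interpolation property of the BDP anticyclotomic `p`-adic `L`-function in Castella's
normalisation** (Castella 2018, Thm. 3.1, p. 9; Castella–Hsieh 2018, Def. 3.5 / Prop. 3.6):
`L ∈ R₀⟦T⟧ = Λ_{R₀}` (`1 + T ↔ γ`, `γ` a topological generator of the anticyclotomic `ℤ_p`-extension
`κ : Γ_K ↠ ℤ_p`) satisfies: for every Hecke character `φ` of `K` that is UNRAMIFIED at all finite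
places and has infinity type `(-n, n)` with `n > 0` in the convention of Castella–Hsieh read through
Mathlib's embedding of the infinite place (tree `HasInfinityType (fun _ ↦ n) (fun _ ↦ -n)`; such a
`φ` is automatically anticyclotomic, see the module docstring), and for every `p`-adic avatar `r` of
`φ` (as a Galois character, `IsPAdicAvatarOf ι φ r`) factoring through `Γ` (`FactorsThroughZp κ r`),
the value of `L` at `T = φ̂(γ) - 1` is

  `ι⁻¹(Γ(n)Γ(n+1) · (1 - a_p p⁻¹ φ(𝔭) + ε_p φ(𝔭)²)² · L(f/K, φ, 1) / (π^{2n+1} Ω_K^{4n})) · Ω_p^{4n}`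

(`bdpInterpolationValue` transported along `ι⁻¹ : ℂ → ℚ̄_p ⊂ ℂ_p`, times `Ω_p^{4n}`). Parameters:
the embedding datum `ι : ℚ̄_p ≃ ℂ`, the distinguished prime `𝔭 ∣ p` of `K` (meant: the one induced by
`ι⁻¹`), `κ`, `γ`, the form `f ∈ S_2(Γ₀(N))` (meant: the newform of `E`, `N` its conductor — `ε_p`
reads `p ∣ N` off the level), and the CM periods `Ω_K ∈ ℂ`, `Ω_p ∈ ℂ_p` (meant: `Ω_K ≠ 0`,
`Ω_p ∈ R₀^×`; Castella–Hsieh §2.5). A characterising PREDICATE, not a construction and not an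
existence claim (that is `castella2018_exists_isBDPLFunction`). Consumer: `IsBDP` of the x11b3
interface, with `ordAtOne L = ord_p [T⁰]L` (`UnrSeries.hasValueAt_zero`).
[cite: Castella2018, Thm. 3.1] [cite: CastellaHsieh2018, §3.3, Def. 3.5, Prop. 3.6] -/
def IsBDPLFunction (ι : PadicAlgCl p ≃+* ℂ) (𝔭 : HeightOneSpectrum (𝓞 K)) (κ : ZpExtension K p)
    (γ : absoluteGaloisGroup K) (f : CuspForm (Gamma0 N) 2) (ΩK : ℂ) (Ωp : ℂ_[p])
    (L : UnrSeries p) : Prop :=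
  ∀ (φ : HeckeCharacter K) (n : ℕ), 0 < n → (∀ v : HeightOneSpectrum (𝓞 K), φ.IsUnramifiedAt v) →
    φ.HasInfinityType (fun _ ↦ (n : ℤ)) (fun _ ↦ -(n : ℤ)) →
    ∀ r : FramedGaloisRep K (PadicAlgCl p) 1, IsPAdicAvatarOf ι φ r → FactorsThroughZp κ r →
      L.HasValueAt (avatarValueAt r γ - 1)
        (((ι.symm (bdpInterpolationValue p f 𝔭 φ n ΩK) : PadicAlgCl p) : ℂ_[p]) * Ωp ^ (4 * n))

/-- **Castella 2018, Theorem 3.1 (existence of `L_p(f) ∈ Λ_{R₀}` with the interpolation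
property)** — named fact, hypotheses as printed (§2.1: `E/ℚ` semistable of conductor `N` — here:
`f` the newform of the elliptic curve `W/ℚ` of squarefree level `N` —, `p ≥ 5` with `ρ̄_{E,p}`
irreducible; `K` imaginary quadratic with `p = 𝔭𝔭̄` split; §3 (Heeg): every prime factor of `N` is
split or ramified in `K`, i.e. has a prime of `K` of residue degree one above it), with `𝔭` the prime
above `p` singled out by the embedding datum `ι` (`k ∈ 𝔭 ↔ |ι⁻¹(k)|_p < 1`, reading `K ⊂ ℂ` through
Mathlib's embedding of its infinite place — the same embedding through which `IsBDPLFunction` reads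
infinity types), `κ` THE anticyclotomic `ℤ_p`-extension and `γ` a topological generator: there are
CM periods `Ω_K ∈ ℂ^×`, `Ω_p ∈ R₀^×` and `L ∈ R₀⟦T⟧` with `IsBDPLFunction ι 𝔭 κ γ f Ω_K Ω_p L`. The
printed theorem names specific periods (Castella–Hsieh 2018, §2.5), not in the tree; quantifying
them existentially makes this statement a consequence of the printed one. SCOPE: for `p ∤ N` this
is Castella–Hsieh 2018, Def. 3.5 + Prop. 3.6 (reformulated, `Tw_{ψ⁻¹}`); for `p ∣ N` the printed
proof is "the construction in [cas-hsieh1] readily extends to the case `p ∣ N` … (cf. [cas-split])",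
with [cas-split] = Castella, Math. Ann. 2017 (arXiv:1507.04260) treating `p ≥ 5` split
multiplicative; nothing is claimed here below `p = 5`. [cite: Castella2018, Thm. 3.1]
[cite: CastellaHsieh2018, Def. 3.5 and Prop. 3.6] -/
def castella2018_exists_isBDPLFunction : Prop :=
  ∀ {p : ℕ} [Fact p.Prime] (ι : PadicAlgCl p ≃+* ℂ) (W : WeierstrassCurve ℚ) [W.IsElliptic]
    (K : Type) [Field K] [NumberField K] (𝔭 : HeightOneSpectrum (𝓞 K)) (κ : ZpExtension K p)
    (γ : absoluteGaloisGroup K) {N : ℕ} [NeZero N] {f : CuspForm (Gamma0 N) 2} (_ : IsNewformOf W f),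
    5 ≤ p → Squarefree N → W.HasIrreducibleModPGaloisRep p →
    IsImaginaryQuadratic K → ((Ideal.span {(p : ℤ)}).primesOver (𝓞 K)).ncard = 2 →
    ((p : ℕ) : 𝓞 K) ∈ 𝔭.asIdeal →
    (∀ (w : InfinitePlace K) (k : 𝓞 K),
      k ∈ 𝔭.asIdeal ↔ ‖ι.symm (w.embedding (k : K))‖ < 1) →
    (∀ ℓ : ℕ, ℓ.Prime → ℓ ∣ N → ∃ v : HeightOneSpectrum (𝓞 K), Ideal.absNorm v.asIdeal = ℓ) →
    κ.IsAnticyclotomic → κ.IsTopGenerator γ →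
    ∃ (ΩK : ℂ) (Ωp : (unrIntegers p)ˣ) (L : UnrSeries p),
      ΩK ≠ 0 ∧ IsBDPLFunction ι 𝔭 κ γ f ΩK ((Ωp : unrIntegers p) : ℂ_[p]) L

/-! #### API -/

variable {ι : PadicAlgCl p ≃+* ℂ} {𝔭 : HeightOneSpectrum (𝓞 K)} {κ : ZpExtension K p}
  {γ : absoluteGaloisGroup K} {f : CuspForm (Gamma0 N) 2} {ΩK : ℂ} {Ωp : ℂ_[p]} {L : UnrSeries p}

/-- Unfolding `IsBDPLFunction` at one character: the prescribed value at `T = φ̂(γ) - 1`.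
[cite: Castella2018, Thm. 3.1] -/
theorem IsBDPLFunction.hasValueAt (hL : IsBDPLFunction ι 𝔭 κ γ f ΩK Ωp L) {φ : HeckeCharacter K}
    {n : ℕ} (hn : 0 < n) (hunr : ∀ v : HeightOneSpectrum (𝓞 K), φ.IsUnramifiedAt v)
    (hinf : φ.HasInfinityType (fun _ ↦ (n : ℤ)) (fun _ ↦ -(n : ℤ)))
    {r : FramedGaloisRep K (PadicAlgCl p) 1} (hr : IsPAdicAvatarOf ι φ r)
    (hκ : FactorsThroughZp κ r) :
    L.HasValueAt (avatarValueAt r γ - 1)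
      (((ι.symm (bdpInterpolationValue p f 𝔭 φ n ΩK) : PadicAlgCl p) : ℂ_[p]) * Ωp ^ (4 * n)) :=
  hL φ n hn hunr hinf r hr hκ

/-- The prescribed value at a character in the range of interpolation is unique: any `v` with
`L.HasValueAt (φ̂(γ) - 1) v` is Castella's right-hand side. [cite: Castella2018, Thm. 3.1] -/
theorem IsBDPLFunction.eq_of_hasValueAt (hL : IsBDPLFunction ι 𝔭 κ γ f ΩK Ωp L)
    {φ : HeckeCharacter K} {n : ℕ} (hn : 0 < n)
    (hunr : ∀ v : HeightOneSpectrum (𝓞 K), φ.IsUnramifiedAt v)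
    (hinf : φ.HasInfinityType (fun _ ↦ (n : ℤ)) (fun _ ↦ -(n : ℤ)))
    {r : FramedGaloisRep K (PadicAlgCl p) 1} (hr : IsPAdicAvatarOf ι φ r)
    (hκ : FactorsThroughZp κ r) {v : ℂ_[p]} (hv : L.HasValueAt (avatarValueAt r γ - 1) v) :
    v = ((ι.symm (bdpInterpolationValue p f 𝔭 φ n ΩK) : PadicAlgCl p) : ℂ_[p]) * Ωp ^ (4 * n) :=
  hv.unique (hL.hasValueAt hn hunr hinf hr hκ)

end Interpolation

end Literature.NumberTheory.EllipticCurves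

end
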